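import Literature.Geometry.Riemannian.EuclideanHypersurfaceContact
import Literature.Geometry.Riemannian.SphericalCylinderEntropy
import Mathlib.Analysis.InnerProductSpace.Adjoint
import HarnessLib

/-!
# The radial normal of a submanifold of the cylinder `S⁴(r) × ℝ ⊂ ℝ⁶` and its mean curvature

Topic `Literature/Geometry/Riemannian`.  For a smooth immersion `f : M → ℝ⁶` (any dimension of
`M`) with image in the cylinder `N_r = {z : |z'| = r}` of radius `r > 0` (`z' =` the first five
coordinates), the radial field `n = r⁻¹ (f', 0)` is a unit normal field along `f`
(`isUnitNormal_radial_of_radius`), and its mean curvature in the tree's convention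
(`K_n(v, w) = ⟪dn v, df w⟫`, `H_n = tr_{f^*δ} K_n`) is

  `H_n(y) = r⁻¹ ∑ᵢ |(df_y bᵢ)'|²`        (`meanCurvature_radial_of_radius`)

for every `f^*δ`-orthonormal basis `b` of `T_y M`, hence `0 ≤ H_n ≤ (dim M)/r`
(`meanCurvature_radial_nonneg`, `meanCurvature_radial_le`).  This is the trace on `TM` of the
second fundamental form of the hypersurface `N_r ⊂ ℝ⁶` (principal curvatures `1/r` (×4), `0`):
the FORCING term of a mean curvature flow constrained to `N_r`, viewed as a forced flow of `ℝ⁶`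
(White 2005, §4: `|β| ≤` trace of the second fundamental form of `N`), which after parabolic
dilation by `λ` (radius `r = λ`) is `O(1/λ)`.  The radius-one, four-dimensional case with the
complementary form `H_n = 4 - |ν'|²` is the Summit-side `meanCurvature_radial_eq`.

Everything is PROVED; no definitions, no named facts.

## References

* B. O'Neill, *Semi-Riemannian Geometry*, Academic Press 1983, Ch. 4, Lemma 4 and pp. 97–100.
  [ONeill1983]
* B. White, *A local regularity theorem for mean curvature flow*, Ann. of Math. 161 (2005), §4.
  [White2005]
-/

noncomputable section

open Bundle Set Function Module Filter
open scoped Manifold ContDiff Topology RealInnerProductSpace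

namespace Literature.Geometry.Riemannian

open Lorentzian Lorentzian.PseudoRiemannianMetric EuclideanHypersurface
open SphericalCylinderEntropy (truncL truncL_apply norm_truncL_le)
open Literature.Geometry.Manifold.CylinderSlice (padL padL_apply_castSucc padL_apply_last)

/-! ### Coordinate algebra of `padL ∘ truncL` -/

/-- **`padL† = truncL`**: the adjoint of the padding `a ↦ (a, 0)` is the truncation
`z ↦ z'`. [folklore] -/
theorem adjoint_padL : ContinuousLinearMap.adjoint padL = truncL := by
  refine ContinuousLinearMap.ext fun v => ext_inner_left ℝ fun a => ?_
  rw [ContinuousLinearMap.adjoint_inner_right]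
  simp only [PiLp.inner_apply, RCLike.inner_apply, conj_trivial]
  rw [Fin.sum_univ_castSucc]
  simp only [padL_apply_castSucc, show (Fin.last 5 : Fin 6) = 5 from rfl, padL_apply_last,
    mul_zero, add_zero, truncL_apply]

/-- `⟪(a, 0), v⟫ = ⟪v', a⟫` (`padL† = truncL`). [folklore] -/
theorem inner_padL_left_eq (a : EuclideanSpace ℝ (Fin 5)) (v : EuclideanSpace ℝ (Fin 6)) :
    ⟪padL a, v⟫ = ⟪truncL v, a⟫ := by
  rw [← adjoint_padL, ContinuousLinearMap.adjoint_inner_left, real_inner_comm]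

/-- On the cylinder of radius `r`, `|z'|² = r²` (from the coordinate form of the constraint).
[folklore] -/
theorem norm_sq_truncL_of_sum_eq {z : EuclideanSpace ℝ (Fin 6)} {c : ℝ}
    (hz : ∑ i : Fin 5, z (Fin.castSucc i) ^ 2 = c) : ‖truncL z‖ ^ 2 = c := by
  rw [EuclideanSpace.norm_sq_eq, ← hz]
  simp [truncL_apply]

variable {m : ℕ} {M : Type*} [TopologicalSpace M] [ChartedSpace (EuclideanSpace ℝ (Fin m)) M]
  [IsManifold (𝓡 m) ∞ M]

/-- Tangent vectors of a map into the cylinder are horizontal-orthogonal to the position: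
`⟪(f y)', (df_y v)'⟫ = 0` (differentiate `|f'|² ≡ r²` along the chart curve). [folklore] -/
theorem inner_truncL_mfderiv_eq_zero {f : M → (EuclideanSpace ℝ (Fin 6))} (hf : ContMDiff (𝓡 m)
      𝓘(ℝ, (EuclideanSpace ℝ (Fin 6))) ∞ f) {r : ℝ}
    (hN : ∀ x, ∑ i : Fin 5, f x (Fin.castSucc i) ^ 2 = r ^ 2) (y : M) (v : TangentSpace (𝓡 m) y) :
    ⟪truncL (f y), truncL ((mfderiv (𝓡 m) 𝓘(ℝ, (EuclideanSpace ℝ (Fin 6))) f y :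
      TangentSpace (𝓡 m) y →L[ℝ] (EuclideanSpace ℝ (Fin 6))) v)⟫ = 0 := by
  set β : ℝ → (EuclideanSpace ℝ (Fin 6)) := f ∘ curveThrough (𝓡 m) y v with hβ
  have hβd : HasDerivAt β ((mfderiv (𝓡 m) 𝓘(ℝ, (EuclideanSpace ℝ (Fin 6))) f y :
      TangentSpace (𝓡 m) y →L[ℝ] (EuclideanSpace ℝ (Fin 6))) v) 0 :=
            hasDerivAt_comp_curveThrough_zero hf y v
  have hT : HasDerivAt (fun s => truncL (β s)) (truncL ((mfderiv (𝓡 m) 𝓘(ℝ, (EuclideanSpace ℝ (Fin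
        6))) f y :
      TangentSpace (𝓡 m) y →L[ℝ] (EuclideanSpace ℝ (Fin 6))) v)) 0 :=
            truncL.hasFDerivAt.comp_hasDerivAt 0 hβd
  have hq := hT.inner ℝ hT
  have hconst : (fun s => ⟪truncL (β s), truncL (β s)⟫) = fun _ => r ^ 2 := by
    funext s
    rw [real_inner_self_eq_norm_sq]
    exact norm_sq_truncL_of_sum_eq (hN _)
  rw [hconst] at hq
  have h0 := (hasDerivAt_const (0 : ℝ) (r ^ 2)).unique hq
  have hβ0 : β 0 = f y := by simp [hβ]
  rw [hβ0, real_inner_comm (truncL (f y)), ← two_mul] at h0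
  linarith

/-- **The radial field `n = r⁻¹ (f', 0)` is a unit normal field** along every smooth map into the
cylinder of radius `r > 0`. [cite: ONeill1983, Ch. 4, pp. 97–100] -/
theorem isUnitNormal_radial_of_radius {f : M → (EuclideanSpace ℝ (Fin 6))} (hf : ContMDiff (𝓡 m)
      𝓘(ℝ, (EuclideanSpace ℝ (Fin 6))) ∞ f)
    {r : ℝ} (hr : 0 < r) (hN : ∀ x, ∑ i : Fin 5, f x (Fin.castSucc i) ^ 2 = r ^ 2) :
    (euclideanMetric (EuclideanSpace ℝ (Fin 6))).IsUnitNormal (𝓡 m) f (fun w => r⁻¹ • padL (truncL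
          (f w))) 1 := by
  refine ⟨fun y v => ?_, fun y => ?_⟩
  · rw [euclideanMetric_apply]
    show ⟪r⁻¹ • padL (truncL (f y)), (mfderiv (𝓡 m) 𝓘(ℝ, (EuclideanSpace ℝ (Fin 6))) f y :
      TangentSpace (𝓡 m) y →L[ℝ] (EuclideanSpace ℝ (Fin 6))) v⟫ = 0
    rw [real_inner_smul_left, inner_padL_left_eq, real_inner_comm,
      inner_truncL_mfderiv_eq_zero hf hN,
      mul_zero]
  · rw [euclideanMetric_apply]
    show ⟪r⁻¹ • padL (truncL (f y)), r⁻¹ • padL (truncL (f y))⟫ = 1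
    rw [real_inner_smul_left, real_inner_smul_right, inner_padL_left_eq,
      show truncL (padL (truncL (f y))) = truncL (f y) from by ext i; simp [truncL_apply],
      real_inner_self_eq_norm_sq, norm_sq_truncL_of_sum_eq (hN y)]
    field_simp

omit [IsManifold (𝓡 m) ∞ M] in
/-- The differential of the radial field: `d(r⁻¹ (f', 0))_y v = r⁻¹ ((df_y v)', 0)`.
[folklore] -/
theorem mfderiv_radial_apply {f : M → (EuclideanSpace ℝ (Fin 6))} (hf : ContMDiff (𝓡 m) 𝓘(ℝ,
      (EuclideanSpace ℝ (Fin 6))) ∞ f) (r : ℝ) (y : M)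
    (v : TangentSpace (𝓡 m) y) :
    (mfderiv (𝓡 m) 𝓘(ℝ, (EuclideanSpace ℝ (Fin 6))) (fun w => r⁻¹ • padL (truncL (f w))) y :
        TangentSpace (𝓡 m) y →L[ℝ] (EuclideanSpace ℝ (Fin 6))) v =
      r⁻¹ • padL (truncL ((mfderiv (𝓡 m) 𝓘(ℝ, (EuclideanSpace ℝ (Fin 6))) f y : TangentSpace (𝓡 m)
            y →L[ℝ] (EuclideanSpace ℝ (Fin 6))) v)) := by
  set P : (EuclideanSpace ℝ (Fin 6)) →L[ℝ] (EuclideanSpace ℝ (Fin 6)) := r⁻¹ • (padL ∘L truncL)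
        with hP
  have hPf : (fun w => r⁻¹ • padL (truncL (f w))) = P ∘ f := by
    funext w; simp [hP]
  have hfd : MDifferentiableAt (𝓡 m) 𝓘(ℝ, (EuclideanSpace ℝ (Fin 6))) f y := (hf
        y).mdifferentiableAt (by simp)
  rw [hPf]
  have h := mfderiv_comp y (P.hasFDerivAt.hasMFDerivAt.mdifferentiableAt) hfd
  rw [h, P.hasFDerivAt.hasMFDerivAt.mfderiv]
  rfl

/-- `⟪r⁻¹ (X', 0), X⟫ = r⁻¹ |X'|²`. [folklore] -/
theorem inner_radial_self (r : ℝ) (X : EuclideanSpace ℝ (Fin 6)) : ⟪r⁻¹ • padL (truncL X), X⟫ = r⁻¹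
      * ‖truncL X‖ ^ 2 := by
  rw [real_inner_smul_left, inner_padL_left_eq, real_inner_self_eq_norm_sq]

/-- Images of an induced-orthonormal frame are unit vectors. [folklore] -/
theorem norm_mfderiv_frame_eq_one {f : M → (EuclideanSpace ℝ (Fin 6))}
    (hf : (euclideanMetric (EuclideanSpace ℝ (Fin 6))).IsSpacelikeImmersion (𝓡 m) f)
    {ι : Type*} [Fintype ι] {y : M} (b : Module.Basis ι ℝ (TangentSpace (𝓡 m) y))
    (hb : ((euclideanMetric (EuclideanSpace ℝ (Fin 6))).inducedMetric f
          contMDiff_pullbackBilin_holds hf).IsOrthonormalFrame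
      y b) (i : ι) :
    ‖(show (EuclideanSpace ℝ (Fin 6)) from (mfderiv (𝓡 m) 𝓘(ℝ, (EuclideanSpace ℝ (Fin 6))) f y :
          TangentSpace (𝓡 m) y →L[ℝ] (EuclideanSpace ℝ (Fin 6))) (b i))‖ = 1 := by
  set X : (EuclideanSpace ℝ (Fin 6)) := (mfderiv (𝓡 m) 𝓘(ℝ, (EuclideanSpace ℝ (Fin 6))) f y :
        TangentSpace (𝓡 m) y →L[ℝ] (EuclideanSpace ℝ (Fin 6))) (b i) with hX
  have h := hb.1 i
  rw [inducedMetric_val, inducedBilin_apply, euclideanMetric_apply] at h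
  have h2 : ‖X‖ ^ 2 = 1 := by
    rw [← real_inner_self_eq_norm_sq]; exact h
  nlinarith [norm_nonneg X, sq_nonneg (‖X‖ - 1)]

variable [(euclideanMetric (EuclideanSpace ℝ (Fin 6))).HasLeviCivita]

/-- **Mean curvature of the radial normal in trace form**: for a smooth immersion into the cylinder
of radius `r > 0` and an `f^*δ`-orthonormal basis `b` of `T_y M`,
`H_n(y) = r⁻¹ ∑ᵢ |(df_y bᵢ)'|²`. [cite: ONeill1983, Ch. 4, Lemma 4 and pp. 97–100]
[cite: White2005, §4] -/
theorem meanCurvature_radial_of_radius {f : M → (EuclideanSpace ℝ (Fin 6))}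
    (hf : (euclideanMetric (EuclideanSpace ℝ (Fin 6))).IsSpacelikeImmersion (𝓡 m) f) {r : ℝ}
    {ι : Type*} [Fintype ι] {y : M} (b : Module.Basis ι ℝ (TangentSpace (𝓡 m) y))
    (hb : ((euclideanMetric (EuclideanSpace ℝ (Fin 6))).inducedMetric f
          contMDiff_pullbackBilin_holds hf).IsOrthonormalFrame
      y b) :
    (euclideanMetric (EuclideanSpace ℝ (Fin 6))).meanCurvature f contMDiff_pullbackBilin_holds hf
        (fun w => r⁻¹ • padL (truncL (f w))) y =
      r⁻¹ * ∑ i, ‖truncL ((mfderiv (𝓡 m) 𝓘(ℝ, (EuclideanSpace ℝ (Fin 6))) f y :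
        TangentSpace (𝓡 m) y →L[ℝ] (EuclideanSpace ℝ (Fin 6))) (b i))‖ ^ 2 := by
  have hfs : ContMDiff (𝓡 m) 𝓘(ℝ, (EuclideanSpace ℝ (Fin 6))) ∞ f := hf.contMDiff_self
  have hns : ContMDiff (𝓡 m) 𝓘(ℝ, (EuclideanSpace ℝ (Fin 6))) ∞ (fun w => r⁻¹ • padL (truncL (f
        w))) :=
    ((r⁻¹ • (padL ∘L truncL) : (EuclideanSpace ℝ (Fin 6)) →L[ℝ] (EuclideanSpace ℝ (Fin
          6))).contDiff.comp_contMDiff hfs).congr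
      (fun w => by simp)
  rw [meanCurvature, PseudoRiemannianMetric.trace_eq_sum_of_isOrthonormalFrame _ b hb,
    Finset.mul_sum]
  refine Finset.sum_congr rfl fun i _ => ?_
  rw [secondFundamentalForm_eq_inner hfs hns y (b i) (b i), mfderiv_radial_apply hfs r y]
  exact inner_radial_self r _

/-- **`0 ≤ H_n ≤ (dim M)/r`** for the radial normal of an immersion into the cylinder of radius
`r > 0` (here with the frame cardinality `|ι|` for `dim M`). [cite: White2005, §4] -/
theorem meanCurvature_radial_nonneg_le {f : M → (EuclideanSpace ℝ (Fin 6))}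
    (hf : (euclideanMetric (EuclideanSpace ℝ (Fin 6))).IsSpacelikeImmersion (𝓡 m) f) {r : ℝ} (hr :
          0 < r)
    {ι : Type*} [Fintype ι] {y : M} (b : Module.Basis ι ℝ (TangentSpace (𝓡 m) y))
    (hb : ((euclideanMetric (EuclideanSpace ℝ (Fin 6))).inducedMetric f
          contMDiff_pullbackBilin_holds hf).IsOrthonormalFrame
      y b) :
    0 ≤ (euclideanMetric (EuclideanSpace ℝ (Fin 6))).meanCurvature f contMDiff_pullbackBilin_holds
          hf
        (fun w => r⁻¹ • padL (truncL (f w))) y ∧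
      (euclideanMetric (EuclideanSpace ℝ (Fin 6))).meanCurvature f contMDiff_pullbackBilin_holds hf
        (fun w => r⁻¹ • padL (truncL (f w))) y ≤ Fintype.card ι / r := by
  rw [meanCurvature_radial_of_radius hf b hb]
  have hle : ∀ i, ‖truncL ((mfderiv (𝓡 m) 𝓘(ℝ, (EuclideanSpace ℝ (Fin 6))) f y :
      TangentSpace (𝓡 m) y →L[ℝ] (EuclideanSpace ℝ (Fin 6))) (b i))‖ ^ 2 ≤ 1 := fun i => by
    set X : (EuclideanSpace ℝ (Fin 6)) := (mfderiv (𝓡 m) 𝓘(ℝ, (EuclideanSpace ℝ (Fin 6))) f y :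
          TangentSpace (𝓡 m) y →L[ℝ] (EuclideanSpace ℝ (Fin 6))) (b i) with hX
    have h : ‖truncL X‖ ≤ 1 := (norm_truncL_le X).trans_eq (norm_mfderiv_frame_eq_one hf b hb i)
    have h0 := norm_nonneg (truncL X)
    show ‖truncL X‖ ^ 2 ≤ 1
    nlinarith
  refine ⟨mul_nonneg (inv_nonneg.2 hr.le) (Finset.sum_nonneg fun i _ => sq_nonneg _), ?_⟩
  calc r⁻¹ * ∑ i, ‖truncL ((mfderiv (𝓡 m) 𝓘(ℝ, (EuclideanSpace ℝ (Fin 6))) f y :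
        TangentSpace (𝓡 m) y →L[ℝ] (EuclideanSpace ℝ (Fin 6))) (b i))‖ ^ 2
      ≤ r⁻¹ * ∑ _i : ι, (1 : ℝ) :=
        mul_le_mul_of_nonneg_left (Finset.sum_le_sum fun i _ => hle i) (inv_nonneg.2 hr.le)
    _ = Fintype.card ι / r := by
        rw [Finset.sum_const, Finset.card_univ, nsmul_eq_mul, mul_one, div_eq_inv_mul]

end Literature.Geometry.Riemannian
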